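import Summits.ResolutionOfSingularities.ResolutionOfSingularities.Theorems.HilbertSamuelEliminationSigmaMaxModificationsCorridor3TameWildNuGluing
import Summits.ResolutionOfSingularities.ResolutionOfSingularities.Theorems.HilbertSamuelEliminationSigmaMaxModificationsStubCentreSeqPackage
import Summits.ResolutionOfSingularities.ResolutionOfSingularities.Theorems.HilbertSamuelEliminationSigmaMaxModificationsNuEliminationData
import Summits.ResolutionOfSingularities.ResolutionOfSingularities.Theorems.HilbertSamuelEliminationSigmaMaxModificationsMaxLocusClosed
import Summits.ResolutionOfSingularities.ResolutionOfSingularities.Theorems.HilbertSamuelEliminationSigmaMaxModificationsSemicontinuitySharp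
import Literature.AlgebraicGeometry.Resolution.HilbertSamuelLocal
import Literature.AlgebraicGeometry.Resolution.QuasiExcellentSchemes
import Mathlib.AlgebraicGeometry.Morphisms.Proper
import Mathlib.AlgebraicGeometry.Noetherian
import HarnessLib

/-!
# Route `HilbertSamuelElimination`, crux `SigmaMaxModificationsCorridor3`
# (stmt-ResolutionOfSingularities-19249; child of `SigmaMaxModifications` stmt-…-18506),
# line `tame_wild` — PACKAGING: `ν`-eliminations (global, or of a neighbourhood of the stratum)
# are `ν`-modifications

[OURS · L1 W4.2] The packaging step "H5" of the crux plan for the open regime stubs `stub_tameNu3` /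
`stub_wildNu3` of line `tame_wild` (whose conclusions are `NuMod Y 3 3 ν`), kernel-checked once and
for all so that a construction of blow-up sequences need not redo it. NOT a statement of any
manuscript. Four bridges into `NuMod Y N d ν` (the Theorems-side copy of the line's definition:
proper, reduced source of dimension `≤ d` and `≤ N`, an isomorphism over every open inside `Y ∖ Y(ν)`,
dense opens inside `Y ∖ Y(ν)` pulled back to dense opens, `H^N` non-increasing, `ν ∉ Σ(N)` upstairs):

* `nuMod_of_centreSeq` — from a GLOBAL blow-up sequence `s : CentreSeq Y` with centres over `Y(ν)`,
  `H^N` non-increasing along `s.comp` and `ν ∉ Σ_{s.top}(N)` (the landed `stub_centreSeq_package`,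
  p146611, read at the two dimension bounds).
* `nuMod_of_isNuElimination` — from a GLOBAL `ν`-ELIMINATION in the sense of CJS Def. 6.14
  (`CentreSeq.IsNuElimination N ν`: permissible centres inside the successive strata `Y_i(ν)`,
  `Y_n(ν) = ∅`) of a reduced `Y` locally of finite type over a field with `ν ∈ Σ_Y(N)^max`:
  UNCONDITIONAL, the Bennett–Hironaka–Singh inequality CJS Thm. 3.10 (1) being PROVED in the tree
  (`CossartJannsenSaito2020_thm_3_10_1_holds`, fed to the landed `nuEliminationData_of_isNuElimination`).
* `nuMod_of_centreSeq_nbhd` — from a blow-up sequence of an OPEN NEIGHBOURHOOD `U₁ ⊇ Y(ν)` only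
  (centres over `U₁(ν) = U₁ ∩ Y(ν)`, `H^N` non-increasing, `ν` killed on top of `U₁`), for `ν`
  maximal and `N ≥ dim Y` over a field: `Y(ν)` is closed (sharp semicontinuity), and the sequence is a
  local `ν`-witness glued with the identity of `Y ∖ Y(ν)` by the landed `ν`-gluing
  `nuMod_of_localWitness` (p459350). This is the form a LOCAL construction (inside a chart where `Y`
  embeds into a regular scheme, say) delivers.
* `nuMod_of_isNuElimination_nbhd` — from a `ν`-elimination (CJS Def. 6.14) of an open neighbourhood
  `U₁ ⊇ Y(ν)`, unconditional as above (`ν` stays maximal in `Σ_{U₁}(N) ⊆ Σ_Y(N)`).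

## Sources

* V. Cossart, U. Jannsen, S. Saito, LNM 2270 (2020), Def. 2.28, Thm. 3.10 (1), Def. 6.14, Rem. 6.24.
  [CossartJannsenSaito2020]
* The Stacks Project, Tags 02OS (blow-up is an isomorphism off the centre), 01LH (gluing).
  [StacksProject]
-/

set_option linter.dupNamespace false -- mandated namespace of this single-conjunct summit

noncomputable section

open CategoryTheory AlgebraicGeometry TopologicalSpace Topology
open Literature.AlgebraicGeometry.Resolution Literature.RingTheory.HilbertSamuel
open Summit.ResolutionOfSingularities.ResolutionOfSingularities.Theorems.SigmaMaxModifications.Sketch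

namespace Summit.ResolutionOfSingularities.ResolutionOfSingularities.Theorems.SigmaMaxModificationsCorridor3.TameWild

/-! ## Global blow-up sequences -/

/-- **A blow-up sequence with centres over `Y(ν)`, `H^N` non-increasing and `ν` killed, is a
`ν`-modification** (inside the class `{dim ≤ d}` for any `d ≥ dim Y`, at any level `N ≥ dim Y`):
`s.comp` is proper, `s.top` reduced of dimension `≤ d` and `≤ N`, an isomorphism over the opens
inside `Y ∖ Y(ν)` with dense preimages of dense such opens (landed `stub_centreSeq_package`: a
blow-up is an isomorphism off its centre, Stacks 02OS; reducedness CJS Thm. 6.6).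
[cite: CossartJannsenSaito2020, Def. 6.14, Rem. 6.24] [cite: StacksProject, Tag 02OS] -/
theorem nuMod_of_centreSeq {Y : Scheme.{0}} [IsLocallyNoetherian Y] [IsReduced Y] {N d : ℕ}
    (hdimd : topologicalKrullDim Y ≤ (d : WithBot ℕ∞))
    (hdimN : topologicalKrullDim Y ≤ (N : WithBot ℕ∞)) {ν : ℕ → ℕ} (s : CentreSeq Y)
    (hover : s.CentresOver (Scheme.hsStratum Y N ν))
    (hmono : ∀ x' : s.top, Scheme.hsFun s.top N x' ≤ Scheme.hsFun Y N (s.comp.base x'))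
    (hkill : ν ∉ Scheme.hsValues s.top N) : NuMod Y N d ν := by
  obtain ⟨hprop, hsred, hsdim, hiso, hdense⟩ :=
    stub_centreSeq_package Y d hdimd (Scheme.hsStratum Y N ν) s hover
  exact ⟨s.top, s.comp, hprop, hsred, hsdim, topologicalKrullDim_top_le s hdimN, hiso, hdense, hmono,
    hkill⟩

/-- **A `ν`-elimination (CJS Def. 6.14) is a `ν`-modification — unconditionally.** For `Y` reduced,
locally of finite type over a field `k`, `dim Y ≤ d`, `dim Y ≤ N`, `ν ∈ Σ_Y(N)^max`, and
`s : CentreSeq Y` a `ν`-elimination at level `N` (permissible centres inside the successive strata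
`Y_i(ν)`, `Y_n(ν) = ∅`): the centres lie over `Y(ν)` and `H^N` does not increase along `s.comp` by the
Bennett–Hironaka–Singh inequality CJS Thm. 3.10 (1), PROVED in the tree
(`CossartJannsenSaito2020_thm_3_10_1_holds`, through the landed `nuEliminationData_of_isNuElimination`),
and `ν ∉ Σ_{s.top}(N)`; then `nuMod_of_centreSeq`.
[cite: CossartJannsenSaito2020, Def. 6.14, Thm. 3.10 (1)] -/
theorem nuMod_of_isNuElimination {k : Type} [Field k] {Y : Scheme.{0}} (g : Y ⟶ Spec (.of k))
    [LocallyOfFiniteType g] [IsReduced Y] {N d : ℕ}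
    (hdimd : topologicalKrullDim Y ≤ (d : WithBot ℕ∞))
    (hdimN : topologicalKrullDim Y ≤ (N : WithBot ℕ∞)) {ν : ℕ → ℕ}
    (hν : Maximal (· ∈ Scheme.hsValues Y N) ν) (s : CentreSeq Y) (hs : s.IsNuElimination N ν) :
    NuMod Y N d ν := by
  haveI : IsLocallyNoetherian Y := LocallyOfFiniteType.isLocallyNoetherian g
  obtain ⟨hover, hmono, hkill⟩ :=
    nuEliminationData_of_isNuElimination CossartJannsenSaito2020_thm_3_10_1_holds g hdimN hν s hs
  exact nuMod_of_centreSeq hdimd hdimN s hover hmono hkill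

/-! ## Blow-up sequences of a neighbourhood of the stratum -/

/-- **A blow-up sequence of an OPEN NEIGHBOURHOOD of the stratum, glued with the identity, is a
`ν`-modification.** For `Y` reduced, locally of finite type and quasi-compact over a field `k`,
`dim Y ≤ d`, `dim Y ≤ N`, a MAXIMAL value `ν` of `Σ_Y(N)`, an open `U₁ ⊇ Y(ν)`, and a blow-up
sequence `s : CentreSeq U₁` with centres over `U₁(ν) = U₁ ∩ Y(ν)`, `H^N` non-increasing along `s.comp`
and `ν ∉ Σ_{s.top}(N)`: `Y(ν)` is closed (`ν` maximal, sharp semicontinuity at `N ≥ dim Y` over a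
field: landed `stub_isClosed_hsMaxLocus_over_field` ∘ `stub_hsFun_le_of_specializes_over_field`), so
`Zc := Y ∖ Y(ν)` and `U₁` cover `Y`; `s.comp` is a local `ν`-witness (landed `stub_centreSeq_package` on
`U₁`: proper, reduced top of dimension `≤ dim U₁ ≤ dim Y`, an isomorphism over `U₁ ∩ Zc = U₁ ∖ U₁(ν)`,
dense opens of `Y` inside `Zc` restrict to dense opens of `U₁` inside `U₁ ∖ U₁(ν)` and pull back
densely; `H^N_{U₁} = H^N_Y|_{U₁}`), and the landed `ν`-gluing `nuMod_of_localWitness` extends it by the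
identity of `Zc`. [cite: CossartJannsenSaito2020, Def. 6.14, Rem. 6.24, Lemma 2.36]
[cite: StacksProject, Tag 01LH] -/
theorem nuMod_of_centreSeq_nbhd {k : Type} [Field k] {Y : Scheme.{0}} (g : Y ⟶ Spec (.of k))
    [LocallyOfFiniteType g] [QuasiCompact g] [IsReduced Y] {N d : ℕ}
    (hdimd : topologicalKrullDim Y ≤ (d : WithBot ℕ∞))
    (hdimN : topologicalKrullDim Y ≤ (N : WithBot ℕ∞)) {ν : ℕ → ℕ}
    (hν : Maximal (· ∈ Scheme.hsValues Y N) ν) (U₁ : Y.Opens)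
    (hU₁ : Scheme.hsStratum Y N ν ⊆ (U₁ : Set Y)) (s : CentreSeq (U₁ : Scheme.{0}))
    (hover : s.CentresOver (Scheme.hsStratum (U₁ : Scheme.{0}) N ν))
    (hmono : ∀ x' : s.top,
      Scheme.hsFun s.top N x' ≤ Scheme.hsFun (U₁ : Scheme.{0}) N (s.comp.base x'))
    (hkill : ν ∉ Scheme.hsValues s.top N) : NuMod Y N d ν := by
  haveI : IsLocallyNoetherian Y := LocallyOfFiniteType.isLocallyNoetherian g
  haveI : IsLocallyNoetherian (U₁ : Scheme.{0}) :=
    LocallyOfFiniteType.isLocallyNoetherian (U₁.ι ≫ g)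
  haveI : IsReduced (U₁ : Scheme.{0}) := isReduced_of_isOpenImmersion U₁.ι
  -- `Y(ν)` is closed: `ν` is maximal and `H^N_Y` is upper semicontinuous at `N ≥ dim Y` over a field
  have husc : ∀ μ : ℕ → ℕ, IsClosed (Scheme.hsStratumGE Y N μ) :=
    (stub_isClosed_hsMaxLocus_over_field stub_hsFun_le_of_specializes_over_field k Y g
      inferInstance inferInstance N hdimN).1
  have hcl : IsClosed (Scheme.hsStratum Y N ν) := Scheme.isClosed_hsStratum_of_maximal husc hν
  let Zc : Y.Opens := ⟨(Scheme.hsStratum Y N ν)ᶜ, hcl.isOpen_compl⟩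
  have hcover : Zc ⊔ U₁ = ⊤ := by
    ext y
    simp only [Opens.coe_sup, Opens.coe_top, Set.mem_univ, iff_true]
    by_cases hy : y ∈ Scheme.hsStratum Y N ν
    · exact Or.inr (hU₁ hy)
    · exact Or.inl hy
  -- the stratum of `U₁` is the trace of the stratum of `Y`
  have hstr : ∀ u : (U₁ : Scheme.{0}), u ∈ Scheme.hsStratum (U₁ : Scheme.{0}) N ν ↔
      U₁.ι.base u ∈ Scheme.hsStratum Y N ν := fun u => by
    rw [Scheme.mem_hsStratum_iff, Scheme.mem_hsStratum_iff, Scheme.hsFun_opens]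
  -- dimension of `U₁`
  have hdimU : topologicalKrullDim (U₁ : Scheme.{0}) ≤ topologicalKrullDim Y :=
    U₁.ι.isOpenEmbedding.isInducing.topologicalKrullDim_le
  -- package the sequence on `U₁`
  obtain ⟨hprop, hsred, hsdimd, hiso, hdense⟩ :=
    stub_centreSeq_package (U₁ : Scheme.{0}) d (hdimU.trans hdimd)
      (Scheme.hsStratum (U₁ : Scheme.{0}) N ν) s hover
  have hsdimN : topologicalKrullDim s.top ≤ (N : WithBot ℕ∞) :=
    topologicalKrullDim_top_le s (hdimU.trans hdimN)
  -- `U₁ ∩ Zc = U₁ ∖ U₁(ν)`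
  have hW : ((U₁.ι ⁻¹ᵁ Zc : (U₁ : Scheme.{0}).Opens) : Set (U₁ : Scheme.{0})) ⊆
      (Scheme.hsStratum (U₁ : Scheme.{0}) N ν)ᶜ := fun u hu hu' => hu ((hstr u).mp hu')
  refine nuMod_of_localWitness Y N d ν hdimd hdimN Zc U₁ rfl hcover s.top s.comp hprop hsred hsdimd
    hsdimN (hiso _ hW) (fun U hUd hU => ?_) (fun x' => ?_) hkill
  · -- dense opens of `Y` inside `Zc` restrict to dense opens of `U₁` inside `U₁ ∖ U₁(ν)`
    refine hdense (U₁.ι ⁻¹ᵁ U) (hUd.preimage U₁.2.isOpenMap_subtype_val) fun u hu hu' => ?_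
    exact hU hu ((hstr u).mp hu')
  · -- `H^N_{U₁} = H^N_Y|_{U₁}`
    rw [← Scheme.hsFun_opens U₁ N (s.comp.base x')]
    exact hmono x'

/-- **A `ν`-elimination (CJS Def. 6.14) of an OPEN NEIGHBOURHOOD of the stratum is a
`ν`-modification — unconditionally.** For `Y` reduced, locally of finite type and quasi-compact over
a field `k`, `dim Y ≤ d`, `dim Y ≤ N`, `ν ∈ Σ_Y(N)^max`, an open `U₁ ⊇ Y(ν)` and a `ν`-elimination
`s : CentreSeq U₁` of `U₁` at level `N`: `ν` is still maximal in `Σ_{U₁}(N) ⊆ Σ_Y(N)` (it is attained on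
`Y(ν) ⊆ U₁`), so the landed `nuEliminationData_of_isNuElimination` with the PROVED CJS Thm. 3.10 (1)
(`CossartJannsenSaito2020_thm_3_10_1_holds`) gives centres over `U₁(ν)`, `H^N` non-increasing and `ν`
killed, and `nuMod_of_centreSeq_nbhd` glues with the identity off the stratum.
[cite: CossartJannsenSaito2020, Def. 6.14, Thm. 3.10 (1), Rem. 6.24] -/
theorem nuMod_of_isNuElimination_nbhd {k : Type} [Field k] {Y : Scheme.{0}} (g : Y ⟶ Spec (.of k))
    [LocallyOfFiniteType g] [QuasiCompact g] [IsReduced Y] {N d : ℕ}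
    (hdimd : topologicalKrullDim Y ≤ (d : WithBot ℕ∞))
    (hdimN : topologicalKrullDim Y ≤ (N : WithBot ℕ∞)) {ν : ℕ → ℕ}
    (hν : Maximal (· ∈ Scheme.hsValues Y N) ν) (U₁ : Y.Opens)
    (hU₁ : Scheme.hsStratum Y N ν ⊆ (U₁ : Set Y)) (s : CentreSeq (U₁ : Scheme.{0}))
    (hs : s.IsNuElimination N ν) : NuMod Y N d ν := by
  haveI : IsLocallyNoetherian Y := LocallyOfFiniteType.isLocallyNoetherian g
  haveI : LocallyOfFiniteType (U₁.ι ≫ g) := inferInstance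
  -- `ν` is maximal in `Σ_{U₁}(N)`: attained on `Y(ν) ⊆ U₁`, and `Σ_{U₁}(N) ⊆ Σ_Y(N)`
  have hνU : Maximal (· ∈ Scheme.hsValues (U₁ : Scheme.{0}) N) ν := by
    obtain ⟨y, hy⟩ := hν.1
    refine ⟨⟨⟨y, hU₁ hy⟩, by rw [Scheme.hsFun_opens]; exact hy⟩, fun μ hμ hνμ => ?_⟩
    exact hν.2 (Scheme.hsValues_subset_of_isOpenImmersion U₁.ι N hμ) hνμ
  have hdimU : topologicalKrullDim (U₁ : Scheme.{0}) ≤ (N : WithBot ℕ∞) :=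
    U₁.ι.isOpenEmbedding.isInducing.topologicalKrullDim_le.trans hdimN
  obtain ⟨hover, hmono, hkill⟩ :=
    nuEliminationData_of_isNuElimination CossartJannsenSaito2020_thm_3_10_1_holds (U₁.ι ≫ g) hdimU
      hνU s hs
  exact nuMod_of_centreSeq_nbhd g hdimd hdimN hν U₁ hU₁ s hover hmono hkill

end Summit.ResolutionOfSingularities.ResolutionOfSingularities.Theorems.SigmaMaxModificationsCorridor3.TameWild

end
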